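import Mathlib.Analysis.Complex.Basic
import Mathlib.Analysis.Calculus.FDeriv.Basic
import Mathlib.Analysis.SpecialFunctions.Exp
import Mathlib.Analysis.SpecialFunctions.Pow.Real
import Mathlib.Topology.Algebra.InfiniteSum.Basic
import HarnessLib

/-!
# Hadamard's factorisation theorem in genus zero — named fact

Trunk T-ANALYSIS support (complex analysis, `Literature/Analysis/Complex`). Leaf L5 of the
decomposition of `Literature.NumberTheory.LFunctions.katkova_rh_iff_pf` (Katkova 2006, §1: "`ξ₁` is an entire function of
order `1/2` … by the Hadamard theorem `ξ₁(z) = C ∏ (1 - z/z_k)`, `Σ 1/|z_k| < ∞`") and of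
`Literature.Analysis.TotalPositivity.pf_taylor_iff_zeros_of_order_lt_one` (Karlin 1968, Ch. 8, Thm. 5.3, entire
case).

**Hadamard's Factorization Theorem** [Conway 1978, Ch. XI, Thm. 3.4]: an entire function `f` of
finite order `λ` has finite genus `μ ≤ λ`. With [Conway 1978, Ch. XI, Def. 2.5 and (2.3)]
(`f(z) = z^m e^{g(z)} ∏ₙ E_μ(z/aₙ)`, `g` a polynomial of degree `≤ μ`, `aₙ` the non-zero zeros with
multiplicity, `Σ |aₙ|^{-(μ+1)} < ∞`) and `E₀(u) = 1 - u`, the case `λ < 1` (so `μ = 0`) reads: if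
moreover `f(0) ≠ 0` (so `m = 0`), then

  `Σₙ 1/|aₙ| < ∞` and `f(z) = f(0) ∏ₙ (1 - z/aₙ)` for all `z ∈ ℂ`.

* `Literature.Analysis.Complex.hadamard_genus_zero` — NAMED FACT, the displayed statement, with the order hypothesis
  in the quantitative form `‖f z‖ ≤ C exp(‖z‖^ρ)` for some `ρ < 1` (which gives order `≤ ρ < 1`,
  [Conway 1978, Ch. XI, Def. 2.13]) and the zeros packaged as the sequence of their inverses
  `bₙ = 1/aₙ` (padded with zeros when `f` has finitely many zeros), so that the conclusion is
  `Σ ‖bₙ‖ < ∞` and `HasProd (fun n => 1 - bₙ z) (f z / f 0)`; the product converges absolutely,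
  hence unconditionally (Mathlib's `HasProd`).

Mathlib (this tree's version) has Jensen's formula (`Mathlib/Analysis/Complex/JensenFormula.lean`)
but no Weierstrass/Hadamard factorisation (searched `Hadamard`, `genus`, `canonical product`).
Nothing is asserted; users take `(h : Literature.Complex.hadamard_genus_zero)`.

## References

* J. B. Conway, *Functions of One Complex Variable I*, 2nd ed., GTM 11, Springer 1978, Ch. XI,
  Def. 2.1 (rank), (2.3), Def. 2.5 (genus), Def. 2.13 (order), Thm. 3.4 (Hadamard).
* B. Ya. Levin, *Distribution of Zeros of Entire Functions*, AMS 1964, Ch. I, §10 (as cited by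
  Katkova 2006, "[lev], p. 24").
-/

noncomputable section

namespace Literature.Analysis.Complex

/-- NAMED FACT (**Hadamard's factorisation theorem, genus `0`** — Conway 1978, Ch. XI, Thm. 3.4
with Def. 2.5: an entire function of order `λ < 1` has genus `0`). If `f : ℂ → ℂ` is entire,
`‖f z‖ ≤ C exp(‖z‖^ρ)` for some `ρ < 1`, and `f 0 ≠ 0`, then there is a sequence `b : ℕ → ℂ`
(the inverses `1/aₙ` of the zeros of `f` repeated with multiplicity, padded with zeros) with
`Σ ‖bₙ‖ < ∞` and `f z / f 0 = ∏ₙ (1 - bₙ z)` for every `z`. Users take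
`(h : hadamard_genus_zero)`. [cite: Conway1978, Ch. XI Thm. 3.4] -/
def hadamard_genus_zero : Prop :=
  ∀ (f : ℂ → ℂ) (ρ C : ℝ), Differentiable ℂ f → ρ < 1 →
    (∀ z : ℂ, ‖f z‖ ≤ C * Real.exp (‖z‖ ^ ρ)) → f 0 ≠ 0 →
      ∃ b : ℕ → ℂ, Summable (fun n => ‖b n‖) ∧
        ∀ z : ℂ, HasProd (fun n => 1 - b n * z) (f z / f 0)

/-- Sanity/non-vacuity of the packaging: for a zero-free `f` (e.g. a non-zero constant, the only
zero-free entire functions of order `< 1`) the conclusion holds with `b = 0`. [folklore] -/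
theorem hadamard_genus_zero.conclusion_const (c : ℂ) (hc : c ≠ 0) :
    ∃ b : ℕ → ℂ, Summable (fun n => ‖b n‖) ∧
      ∀ z : ℂ, HasProd (fun n => 1 - b n * z) ((fun _ : ℂ => c) z / (fun _ : ℂ => c) 0) := by
  refine ⟨0, by simp [summable_zero], fun z => ?_⟩
  simp [hc]

end Literature.Analysis.Complex
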